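import Literature.Probability.LatticeModels.MeshDomainBigComponents
import HarnessLib

/-!
# Stray mesh components of a Jordan domain are shallow
— (T) brick of line `symplectic-fermion-anchor`
(crux `SAWLoopFugacityFlow.AvoidanceLimit`, stmt-CriticalPhenomena-10649)

`meshDomain Ω δ` is the union of the connected components of maximal cardinality of the mesh
graph `meshVertexGraph Ω δ` on `Ω ∩ δℤ²`. For a Jordan domain `N` and `ε > 0`, for all small
meshes `δ`, every mesh vertex `x` *not* in `meshDomain N.carrier δ` has an `ε`-shallow component:
every mesh vertex joined to `x` lies within `ε` of `N.carrierᶜ`.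

Proof: the compact `K_ε = {z | ε ≤ dist(z, Nᶜ)} ⊆ N.carrier`
(`JordanDomain.isCompact_setOf_le_infDist_compl`) is swallowed by `meshDomain` for small `δ`
(`JordanDomain.eventually_forall_mem_meshDomain'`, `MeshDomainJordan.lean`), and `meshDomain` is
a union of whole mesh components (`mem_meshDomain_of_reachable_meshVertexGraph`,
`MeshDomainBigComponents.lean`); so a vertex joined to `x` at depth `≥ ε` would put `x` in
`meshDomain`. Folklore; no definitions.
-/

noncomputable section

open scoped Topology
open Filter Literature.Probability.RandomPlanarGeometry Literature.Probability.LatticeModels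

namespace Summit.CriticalPhenomena.SAWScalingLimit.Theorems.AvoidanceLimit.Anchor

/-- **Stray mesh components are shallow.** For a Jordan domain `N` and `ε > 0`, for all
sufficiently small meshes `δ > 0`: if a mesh vertex `x` of `N.carrier ∩ δℤ²` is not in the discrete
domain `meshDomain N.carrier δ` (the union of the largest mesh components), then every mesh vertex
`z` joined to `x` in the mesh graph on mesh vertices has its mesh point within `ε` of
`N.carrierᶜ`. Indeed the `ε`-deep compact `{w | ε ≤ infDist w N.carrierᶜ}` is swallowed by
`meshDomain` for small `δ` (`JordanDomain.eventually_forall_mem_meshDomain'`), and `meshDomain` is a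
union of whole components (`mem_meshDomain_of_reachable_meshVertexGraph`). [folklore] -/
theorem meshStray_of_not_mem_meshDomain :
    ∀ (N : JordanDomain) (ε : ℝ), 0 < ε → ∀ᶠ δ in 𝓝[>] (0 : ℝ),
      ∀ x : ↥(meshVertices N.carrier δ), (x : Site 2) ∉ meshDomain N.carrier δ →
        ∀ z : ↥(meshVertices N.carrier δ), (meshVertexGraph N.carrier δ).Reachable x z →
          Metric.infDist (meshPoint δ (z : Site 2)) N.carrierᶜ < ε := by
  intro N ε hε
  obtain ⟨hKc, hKΩ⟩ := N.isCompact_setOf_le_infDist_compl hε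
  filter_upwards [N.eventually_forall_mem_meshDomain' hKc hKΩ] with δ hδ
  intro x hx z hxz
  by_contra hge
  push Not at hge
  exact hx (mem_meshDomain_of_reachable_meshVertexGraph (hδ.1 (z : Site 2) hge) z.2 x.2 hxz.symm)

end Summit.CriticalPhenomena.SAWScalingLimit.Theorems.AvoidanceLimit.Anchor

end
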